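import Summits.ValiantsHypothesis.ValiantsHypothesis.Theorems.RigidityForcesSymmetryGrenetFirstOrderRankRigidBlockIIExtraPrelim

/-!
# Route RigidityForcesSymmetry — `GrenetFirstOrderRankRigid` (item stmt-ValiantsHypothesis-21029),
line `grenet_gauge`: stub `stub_linearRigid`, step 5 (block II, design E2) — the block terms at the
left-anchored extra-cell point

For the crux line `Cruxes/GrenetFirstOrderRankRigid/Lines/grenet_gauge.lean` (blueprint
`Lines/grenet_gauge-stub_linearRigid-PROOF.md`, §5, block II; NOTES "TYPE II FORMAL PLAN").
Design E2 of the overlap block `(A, k₀)` (`u = |A| + k₀`), for `C ⊆ Aᶜ` with `|C| = k₀`, `φ ∈ C` and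
`αₐ ∈ A`: the 0/1 point of a permutation `π` with `π({c < k₀}) = (C - φ) + αₐ`,
`π({c < u-1}) = (A ∪ C) - φ`, `π({c < u}) = A ∪ C` (so `π(u-1) = φ`), together with the extra cell
`x_{αₐ, u-1} = 1` (`αₐ = π c₁`, `c₁ < k₀`).  At this point the cofactor term of

* a tail entry `ρ[T, p]` of the block evaluates to `[p = αₐ] - [T = C ∧ p = φ]`
  (`blockII_extraA_eval_tail`);
* a head entry `κ[C', p]` evaluates to `[p = α₁] - [C' = C ∧ p = α₁]`, where `α₁ = π(k₀)` if
  `|A| ≥ 2` and `α₁ = αₐ` if `|A| = 1` (`blockII_extraA_eval_head`).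

No new definitions.  VP ≠ VNP is not moved by this file.
-/

noncomputable section

open MvPolynomial Matrix Finset

namespace Summit.ValiantsHypothesis.Theorems.RigidityForcesSymmetry.GrenetGauge

open Literature.Computability.AlgebraicComplexity

section Extra

variable (k : Type*) [CommRing k] {n : ℕ}

/-- **E2, tail entries.**  At the left-anchored extra-cell point of the block `(A, k₀)` (see the file
header), the cofactor term of a tail entry `ρ[T, p]` (`S + p = A ⊔ T`, `v = (p, u-1)`) evaluates to
`[p = αₐ] - [T = C ∧ p = φ]`. [cite: Grenet2011, Thm. 1] -/
theorem blockII_extraA_eval_tail (π : Equiv.Perm (Fin n)) (A C : Finset (Fin n)) (k₀ : ℕ) {u : ℕ}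
    (huA : A.card + k₀ = u) (hul : u - 1 < n) (hCA : C ⊆ Aᶜ)
    (φ αₐ : Fin n) (hφ : φ ∈ C) (hαₐ : αₐ ∈ A) (c₁ : Fin n) (hc₁ : (c₁ : ℕ) < k₀) (hπc₁ : π c₁ = αₐ)
    (hs1 : (univ.filter fun c : Fin n => (c : ℕ) < k₀).image π = insert αₐ (C.erase φ))
    (hs2 : (univ.filter fun c : Fin n => (c : ℕ) < u - 1).image π = (A ∪ C).erase φ)
    (hs3 : (univ.filter fun c : Fin n => (c : ℕ) < u).image π = A ∪ C)
    (S T : Finset (Fin n)) (v : Fin n × Fin n) (ht : v.1 ∉ S ∧ (v.2 : ℕ) = S.card) (hTsub : T ⊆ Aᶜ)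
    (hTk : T.card = k₀) (hUS : insert v.1 S = A ∪ T) (hq : (v.2 : ℕ) = u - 1) :
    eval (fun w : Fin n × Fin n => if π w.2 = w.1 ∨ (w.2 = (⟨u - 1, hul⟩ : Fin n) ∧ w.1 = π c₁) then (1 : k) else 0) (perPoly (Fin n) k * (1 - Grenet.adj k n).adjugate T S * X v
          - (1 - Grenet.adj k n).adjugate ∅ S * X v * (1 - Grenet.adj k n).adjugate T univ)
      = (if v.1 = αₐ then 1 else 0) - (if T = C ∧ v.1 = φ then 1 else 0) := by
  have hdisjT : Disjoint A T := Finset.disjoint_left.mpr fun x hxA hxT => (Finset.mem_compl.mp (hTsub hxT)) hxA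
  have hdisjC : Disjoint A C := Finset.disjoint_left.mpr fun x hxA hxC => (Finset.mem_compl.mp (hCA hxC)) hxA
  have hScard : S.card = u - 1 := by rw [← ht.2, hq]
  have hSeq : S = (A ∪ T).erase v.1 := by rw [← hUS, Finset.erase_insert ht.1]
  have hv2 : v.2 = ⟨u - 1, hul⟩ := Fin.ext hq
  have hαT : αₐ ∉ T := fun h => Finset.disjoint_left.mp hdisjT hαₐ h
  have hαC : αₐ ∉ C := fun h => Finset.disjoint_left.mp hdisjC hαₐ h
  have hφA : φ ∉ A := fun h => Finset.disjoint_left.mp hdisjC h hφ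
  have hφα : φ ≠ αₐ := fun h => hφA (h ▸ hαₐ)
  have hA : 0 < A.card := Finset.card_pos.mpr ⟨αₐ, hαₐ⟩
  have hu1 : 0 < u := by omega
  have hc01 : (⟨u - 1, hul⟩ : Fin n) ≠ c₁ := Fin.ne_of_val_ne (show u - 1 ≠ (c₁ : ℕ) by omega)
  -- derived slices
  have hπl : π ⟨u - 1, hul⟩ = φ := by
    have h := perm_apply_pred_mem_sdiff π hu1 hul
    rw [hs3, hs2, Finset.mem_sdiff, Finset.mem_erase, not_and'] at h
    by_contra hne
    exact h.2 h.1 hne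
  have hSLa : (univ.filter fun c : Fin n => k₀ ≤ (c : ℕ) ∧ (c : ℕ) < u - 1).image π = A.erase αₐ := by
    rw [permSlice_eq_sdiff π (by omega), hs2, hs1]
    ext x
    simp only [Finset.mem_sdiff, Finset.mem_erase, Finset.mem_union, Finset.mem_insert, not_or, ne_eq]
    constructor
    · rintro ⟨⟨hne, hA' | hC'⟩, hnα, hnC⟩
      · exact ⟨hnα, hA'⟩
      · exact absurd ⟨hne, hC'⟩ hnC
    · rintro ⟨hnα, hA'⟩
      exact ⟨⟨fun h => hφA (h ▸ hA'), Or.inl hA'⟩, hnα, fun h => Finset.disjoint_left.mp hdisjC hA' h.2⟩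
  have hSLtop : (univ.filter fun c : Fin n => k₀ ≤ (c : ℕ) ∧ (c : ℕ) < n).image π = (insert αₐ (C.erase φ))ᶜ := by
    rw [permSlice_to_top, hs1]
  have hSdT : S \ T = A.erase v.1 := by rw [hSeq]; exact erase_union_sdiff_of_disjoint hdisjT _
  -- `insert αₐ (Kᶜ - φ) = Cᶜ` for `K = (C - φ) + αₐ`
  have hZ : insert αₐ (((insert αₐ (C.erase φ))ᶜ).erase φ) = Cᶜ := by
    ext x
    simp only [Finset.mem_insert, Finset.mem_erase, Finset.mem_compl, not_or, ne_eq]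
    constructor
    · rintro (rfl | ⟨hne, -, hnC⟩)
      · exact hαC
      · exact fun hx => hnC ⟨hne, hx⟩
    · intro hx
      by_cases hxa : x = αₐ
      · exact Or.inl hxa
      · exact Or.inr ⟨fun h => hx (h ▸ hφ), hxa, fun h => hx h.2⟩
  -- the evaluations
  have eX : eval (fun w : Fin n × Fin n => if π w.2 = w.1 ∨ (w.2 = (⟨u - 1, hul⟩ : Fin n) ∧ w.1 = π c₁) then (1 : k) else 0) (X v) = if (φ = v.1 ∨ v.1 = αₐ) then 1 else 0 := by
    rw [eval_X, hv2]
    simp only [hπl, hπc₁, true_and]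
  have eTS : eval (fun w : Fin n × Fin n => if π w.2 = w.1 ∨ (w.2 = (⟨u - 1, hul⟩ : Fin n) ∧ w.1 = π c₁) then (1 : k) else 0) ((1 - Grenet.adj k n).adjugate T S) = if v.1 = αₐ then 1 else 0 := by
    rw [evalPermExtra_grenet_W k π ⟨u - 1, hul⟩ c₁ hc01 T S (by rw [hTk, hScard]; omega), hTk, hScard, hSLa]
    simp only [lt_irrefl, false_and, and_false, if_false, add_zero, disjoint_and_union_eq_iff, hSdT]
    by_cases hp : v.1 = αₐ
    · rw [if_pos hp, if_pos]
      refine ⟨fun x hx => ?_, by rw [hp]⟩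
      rw [hSeq, hp]
      exact Finset.mem_erase.mpr ⟨fun h => hαT (h ▸ hx), Finset.mem_union_right _ hx⟩
    · rw [if_neg hp, if_neg]
      rintro ⟨-, h⟩
      exact hp ((Finset.erase_inj A hαₐ).mp h.symm).symm
  have e0S : eval (fun w : Fin n × Fin n => if π w.2 = w.1 ∨ (w.2 = (⟨u - 1, hul⟩ : Fin n) ∧ w.1 = π c₁) then (1 : k) else 0) ((1 - Grenet.adj k n).adjugate ∅ S) = if (A ∪ C).erase φ = S then 1 else 0 := by
    rw [evalPermExtra_grenet_W k π ⟨u - 1, hul⟩ c₁ hc01 ∅ S (by simp), Finset.card_empty, hScard,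
      permSlice_zero, hs2]
    simp only [lt_irrefl, false_and, and_false, if_false, add_zero, Finset.disjoint_empty_left, true_and,
      Finset.empty_union]
  have eTU : eval (fun w : Fin n × Fin n => if π w.2 = w.1 ∨ (w.2 = (⟨u - 1, hul⟩ : Fin n) ∧ w.1 = π c₁) then (1 : k) else 0) ((1 - Grenet.adj k n).adjugate T univ) = if T = C then 1 else 0 := by
    rw [evalPermExtra_grenet_W k π ⟨u - 1, hul⟩ c₁ hc01 T univ (by rw [Finset.card_univ]; exact Finset.card_le_univ T),
      hTk, Finset.card_univ, Fintype.card_fin, hSLtop, hπc₁, hπl, hZ]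
    have h1 : ¬ (Disjoint T (insert αₐ (C.erase φ))ᶜ ∧ T ∪ (insert αₐ (C.erase φ))ᶜ = univ) := fun h =>
      hαT ((disjoint_compl_and_union_iff.mp h).symm ▸ Finset.mem_insert_self _ _)
    have h2 : (k₀ ≤ u - 1 ∧ u - 1 < n ∧ ¬ (k₀ ≤ (c₁ : ℕ) ∧ (c₁ : ℕ) < n) ∧ Disjoint T Cᶜ ∧ T ∪ Cᶜ = univ) ↔ T = C := by
      rw [disjoint_compl_and_union_iff]
      constructor
      · exact fun h => h.2.2.2
      · exact fun h => ⟨by omega, hul, by omega, h⟩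
    simp only [h1, if_false, zero_add, h2]
  rw [map_sub, map_mul, map_mul, map_mul, map_mul, evalExtra_perPoly k π _ _ hc01, eTS, eX, e0S, eTU]
  by_cases hp : v.1 = αₐ
  · have hne : ¬ ((A ∪ C).erase φ = S) := fun h => by
      have hmem : αₐ ∈ S := h ▸ Finset.mem_erase.mpr ⟨hφα.symm, Finset.mem_union_left _ hαₐ⟩
      rw [hSeq, hp] at hmem
      exact Finset.notMem_erase _ _ hmem
    simp [hp, hne, hφα.symm]
  · by_cases hφp : v.1 = φ
    · by_cases hTC : T = C
      · have hyes : (A ∪ C).erase φ = S := by rw [hSeq, hφp, hTC]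
        simp [hφp, hTC, hyes]
      · simp [hφp, hTC]
    · have h1 : φ ≠ v.1 := fun h => hφp h.symm
      simp [hp, hφp, h1]

/-- **E2, head entries.**  At the left-anchored extra-cell point of the block `(A, k₀)`, the cofactor
term of a head entry `κ[C', p]` (`S = A ⊔ C'`, `T = C' + p`, `v = (p, k₀)`) evaluates to
`[p = α₁] - [C' = C ∧ p = α₁]`, where `α₁ = π(k₀)` if `|A| ≥ 2` and `α₁ = αₐ` if `|A| = 1`.
[cite: Grenet2011, Thm. 1] -/
theorem blockII_extraA_eval_head (π : Equiv.Perm (Fin n)) (A C : Finset (Fin n)) (k₀ : ℕ) {u : ℕ}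
    (huA : A.card + k₀ = u) (hul : u - 1 < n) (hkn : k₀ < n) (hCA : C ⊆ Aᶜ)
    (φ αₐ : Fin n) (hφ : φ ∈ C) (hαₐ : αₐ ∈ A) (c₁ : Fin n) (hc₁ : (c₁ : ℕ) < k₀) (hπc₁ : π c₁ = αₐ)
    (hs1 : (univ.filter fun c : Fin n => (c : ℕ) < k₀).image π = insert αₐ (C.erase φ))
    (hs2 : (univ.filter fun c : Fin n => (c : ℕ) < u - 1).image π = (A ∪ C).erase φ)
    (hs3 : (univ.filter fun c : Fin n => (c : ℕ) < u).image π = A ∪ C)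
    (S T : Finset (Fin n)) (v : Fin n × Fin n) (hh : v.1 ∈ T ∧ T.card = (v.2 : ℕ) + 1)
    (hCsub : T.erase v.1 ⊆ Aᶜ) (hCk' : (T.erase v.1).card = k₀) (hS : S = A ∪ T.erase v.1)
    (hq : (v.2 : ℕ) = k₀) (α₁ : Fin n) (hα₁ : k₀ < u - 1 → α₁ = π ⟨k₀, hkn⟩) (hα₁' : u - 1 = k₀ → α₁ = αₐ) :
    eval (fun w : Fin n × Fin n => if π w.2 = w.1 ∨ (w.2 = (⟨u - 1, hul⟩ : Fin n) ∧ w.1 = π c₁) then (1 : k) else 0) (perPoly (Fin n) k * (1 - Grenet.adj k n).adjugate T S * X v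
          - (1 - Grenet.adj k n).adjugate ∅ S * X v * (1 - Grenet.adj k n).adjugate T univ)
      = (if v.1 = α₁ then 1 else 0) - (if T.erase v.1 = C ∧ v.1 = α₁ then 1 else 0) := by
  have hdisjC' : Disjoint A (T.erase v.1) :=
    Finset.disjoint_left.mpr fun x hxA hx => (Finset.mem_compl.mp (hCsub hx)) hxA
  have hdisjC : Disjoint A C := Finset.disjoint_left.mpr fun x hxA hxC => (Finset.mem_compl.mp (hCA hxC)) hxA
  have hpC' : v.1 ∉ T.erase v.1 := Finset.notMem_erase _ _
  have hTcard : T.card = k₀ + 1 := by rw [hh.2, hq]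
  have hScard : S.card = u := by rw [hS, Finset.card_union_of_disjoint hdisjC', hCk', huA]
  have hv2 : v.2 = ⟨k₀, hkn⟩ := Fin.ext hq
  have hαC : αₐ ∉ C := fun h => Finset.disjoint_left.mp hdisjC hαₐ h
  have hφA : φ ∉ A := fun h => Finset.disjoint_left.mp hdisjC h hφ
  have hφα : φ ≠ αₐ := fun h => hφA (h ▸ hαₐ)
  have hA : 0 < A.card := Finset.card_pos.mpr ⟨αₐ, hαₐ⟩
  have hu1 : 0 < u := by omega
  have hc01 : (⟨u - 1, hul⟩ : Fin n) ≠ c₁ := Fin.ne_of_val_ne (show u - 1 ≠ (c₁ : ℕ) by omega)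
  have hπl : π ⟨u - 1, hul⟩ = φ := by
    have h := perm_apply_pred_mem_sdiff π hu1 hul
    rw [hs3, hs2, Finset.mem_sdiff, Finset.mem_erase, not_and'] at h
    by_contra hne
    exact h.2 h.1 hne
  -- the only element of `T` in `A` can be `p`
  have hkey : ∀ x ∈ T, x ∈ A → x = v.1 := fun x hx hxA => by
    by_contra hne
    exact (Finset.mem_compl.mp (hCsub (Finset.mem_erase.mpr ⟨hne, hx⟩))) hxA
  have hTeq : ∀ β ∈ A, (T = insert β C ↔ (T.erase v.1 = C ∧ v.1 = β)) := by
    intro β hβ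
    constructor
    · intro h
      have hβv : β = v.1 := hkey β (h ▸ Finset.mem_insert_self _ _) hβ
      refine ⟨?_, hβv.symm⟩
      rw [h, ← hβv, Finset.erase_insert (fun h' => Finset.disjoint_left.mp hdisjC hβ h')]
    · rintro ⟨h1, h2⟩
      rw [← h1, ← h2, Finset.insert_erase hh.1]
  have hSdT : S \ T = A.erase v.1 := by rw [hS]; exact union_erase_sdiff_eq hh.1 hdisjC'
  have hTS : T ⊆ S ↔ v.1 ∈ A := by
    constructor
    · intro h
      have := h hh.1
      rw [hS, Finset.mem_union] at this
      exact this.resolve_right hpC'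
    · intro h x hx
      rw [hS, Finset.mem_union]
      by_cases hxv : x = v.1
      · exact Or.inl (hxv ▸ h)
      · exact Or.inr (Finset.mem_erase.mpr ⟨hxv, hx⟩)
  -- the evaluations
  have eTS : eval (fun w : Fin n × Fin n => if π w.2 = w.1 ∨ (w.2 = (⟨u - 1, hul⟩ : Fin n) ∧ w.1 = π c₁) then (1 : k) else 0) ((1 - Grenet.adj k n).adjugate T S) = if v.1 = α₁ then 1 else 0 := by
    rw [evalPermExtra_grenet_W k π ⟨u - 1, hul⟩ c₁ hc01 T S (by rw [hTcard, hScard]; omega), hTcard, hScard]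
    simp only [disjoint_and_union_eq_iff, hSdT, hπc₁, hπl]
    rcases Nat.lt_or_ge k₀ (u - 1) with hlt | hge
    · -- `|A| ≥ 2`
      have hα₁eq := hα₁ hlt
      have hα₁A : α₁ ∈ A.erase αₐ := by
        have : π ⟨k₀, hkn⟩ ∈ (univ.filter fun c : Fin n => k₀ ≤ (c : ℕ) ∧ (c : ℕ) < u - 1).image π := by
          rw [mem_permSlice, Equiv.symm_apply_apply]; exact ⟨le_rfl, hlt⟩
        rw [permSlice_eq_sdiff π (by omega), hs2, hs1, ← hα₁eq, Finset.mem_sdiff, Finset.mem_erase,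
          Finset.mem_union, Finset.mem_insert, not_or, Finset.mem_erase, not_and'] at this
        obtain ⟨⟨hne, hA' | hC'⟩, hnα, hnC⟩ := this
        · exact Finset.mem_erase.mpr ⟨hnα, hA'⟩
        · exact absurd hne (hnC hC')
      have hZ₂ : (univ.filter fun c : Fin n => k₀ + 1 ≤ (c : ℕ) ∧ (c : ℕ) < u).image π
          = (insert φ (A.erase αₐ)).erase α₁ := by
        have h := permSlice_succ_left π (s := k₀) (t := u) (by omega) hkn
        rw [permSlice_eq_sdiff π (show k₀ ≤ u by omega), hs3, hs1] at h
        have hnm : π ⟨k₀, hkn⟩ ∉ (univ.filter fun c : Fin n => k₀ + 1 ≤ (c : ℕ) ∧ (c : ℕ) < u).image π :=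
          perm_notMem_permSlice_of_lt π _ (Nat.lt_succ_self k₀)
        rw [← Finset.erase_insert hnm, ← h, ← hα₁eq]
        congr 1
        ext x
        simp only [Finset.mem_sdiff, Finset.mem_union, Finset.mem_insert, Finset.mem_erase, not_or, ne_eq]
        constructor
        · rintro ⟨hA' | hC', hnα, hnC⟩
          · exact Or.inr ⟨hnα, hA'⟩
          · exact Or.inl (by_contra fun hxφ => hnC ⟨hxφ, hC'⟩)
        · rintro (rfl | ⟨hnα, hA'⟩)
          · exact ⟨Or.inr hφ, hφα, fun h => h.1 rfl⟩
          · exact ⟨Or.inl hA', hnα, fun h => Finset.disjoint_left.mp hdisjC hA' h.2⟩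
      rw [hZ₂]
      have n1 : ¬ (T ⊆ S ∧ A.erase v.1 = (insert φ (A.erase αₐ)).erase α₁) := fun h => by
        have : φ ∈ A.erase v.1 := h.2 ▸ Finset.mem_erase.mpr
          ⟨fun h' => hφA (h' ▸ Finset.mem_of_mem_erase hα₁A), Finset.mem_insert_self _ _⟩
        exact hφA (Finset.mem_of_mem_erase this)
      have hZ₂' : insert αₐ (((insert φ (A.erase αₐ)).erase α₁).erase φ) = A.erase α₁ := by
        ext x
        simp only [Finset.mem_insert, Finset.mem_erase, ne_eq]
        constructor
        · rintro (rfl | ⟨hxφ, hxα, rfl | ⟨hxa, hxA⟩⟩)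
          · exact ⟨fun h => (Finset.ne_of_mem_erase hα₁A) h.symm, hαₐ⟩
          · exact absurd rfl hxφ
          · exact ⟨hxα, hxA⟩
        · rintro ⟨hxα, hxA⟩
          by_cases hxa : x = αₐ
          · exact Or.inl hxa
          · exact Or.inr ⟨fun h => hφA (h ▸ hxA), hxα, Or.inr ⟨hxa, hxA⟩⟩
      rw [hZ₂', if_neg n1, zero_add]
      by_cases hp : v.1 = α₁
      · rw [if_pos hp, if_pos]
        exact ⟨by omega, by omega, by omega, hTS.mpr (hp ▸ Finset.mem_of_mem_erase hα₁A), by rw [hp]⟩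
      · rw [if_neg hp, if_neg]
        rintro ⟨-, -, -, -, h⟩
        exact hp (((Finset.erase_inj A (Finset.mem_of_mem_erase hα₁A)).mp h.symm).symm)
    · -- `|A| = 1`
      have hα₁eq := hα₁' (by omega)
      have hZ₂ : (univ.filter fun c : Fin n => k₀ + 1 ≤ (c : ℕ) ∧ (c : ℕ) < u).image π = ∅ := by
        ext x; rw [mem_permSlice]; simp only [Finset.notMem_empty, iff_false]; omega
      rw [hZ₂]
      have hAone : A = {αₐ} := by
        obtain ⟨a, ha⟩ := Finset.card_eq_one.mp (show A.card = 1 by omega)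
        rw [ha] at hαₐ ⊢; rw [Finset.mem_singleton.mp hαₐ]
      have n2 : ¬ (k₀ + 1 ≤ u - 1 ∧ u - 1 < u ∧ ¬ (k₀ + 1 ≤ (c₁ : ℕ) ∧ (c₁ : ℕ) < u) ∧ T ⊆ S ∧
          A.erase v.1 = insert αₐ ((∅ : Finset (Fin n)).erase φ)) := fun h => by omega
      rw [if_neg n2, add_zero]
      by_cases hp : v.1 = α₁
      · rw [if_pos hp, if_pos]
        refine ⟨hTS.mpr (by rw [hp, hα₁eq]; exact hαₐ), ?_⟩
        rw [hp, hα₁eq, hAone, Finset.erase_singleton]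
      · rw [if_neg hp, if_neg]
        rintro ⟨h1, h2⟩
        have hvA := hTS.mp h1
        rw [hAone, Finset.mem_singleton] at hvA
        exact hp (hvA.trans hα₁eq.symm)
  have e0S : eval (fun w : Fin n × Fin n => if π w.2 = w.1 ∨ (w.2 = (⟨u - 1, hul⟩ : Fin n) ∧ w.1 = π c₁) then (1 : k) else 0) ((1 - Grenet.adj k n).adjugate ∅ S) = if T.erase v.1 = C then 1 else 0 := by
    rw [evalPermExtra_grenet_W k π ⟨u - 1, hul⟩ c₁ hc01 ∅ S (by simp), Finset.card_empty, hScard,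
      permSlice_zero, hs3]
    have hc₁u : (0 ≤ (c₁ : ℕ) ∧ (c₁ : ℕ) < u) := ⟨Nat.zero_le _, by omega⟩
    simp only [hc₁u, not_true_eq_false, false_and, and_false, if_false, add_zero, Finset.disjoint_empty_left,
      true_and, Finset.empty_union]
    rw [hS]
    by_cases hC : T.erase v.1 = C
    · rw [if_pos hC, if_pos (by rw [hC])]
    · rw [if_neg hC, if_neg (fun h => hC ((union_eq_union_iff_of_disjoint hdisjC hdisjC').mp h).symm)]
  have eTU : eval (fun w : Fin n × Fin n => if π w.2 = w.1 ∨ (w.2 = (⟨u - 1, hul⟩ : Fin n) ∧ w.1 = π c₁) then (1 : k) else 0) ((1 - Grenet.adj k n).adjugate T univ)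
      = if (T.erase v.1 = C ∧ v.1 = α₁) then 1 else 0 := by
    rw [evalPermExtra_grenet_W k π ⟨u - 1, hul⟩ c₁ hc01 T univ (by rw [Finset.card_univ]; exact Finset.card_le_univ T),
      hTcard, Finset.card_univ, Fintype.card_fin, permSlice_to_top, Grenet.prefix_image_succ π hkn, hs1, hπc₁, hπl]
    simp only [disjoint_compl_and_union_iff]
    rcases Nat.lt_or_ge k₀ (u - 1) with hlt | hge
    · -- `|A| ≥ 2`
      have hα₁eq := hα₁ hlt
      have hα₁A : α₁ ∈ A.erase αₐ := by
        have : π ⟨k₀, hkn⟩ ∈ (univ.filter fun c : Fin n => k₀ ≤ (c : ℕ) ∧ (c : ℕ) < u - 1).image π := by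
          rw [mem_permSlice, Equiv.symm_apply_apply]; exact ⟨le_rfl, hlt⟩
        rw [permSlice_eq_sdiff π (by omega), hs2, hs1, ← hα₁eq, Finset.mem_sdiff, Finset.mem_erase,
          Finset.mem_union, Finset.mem_insert, not_or, Finset.mem_erase, not_and'] at this
        obtain ⟨⟨hne, hA' | hC'⟩, hnα, hnC⟩ := this
        · exact Finset.mem_erase.mpr ⟨hnα, hA'⟩
        · exact absurd hne (hnC hC')
      rw [← hα₁eq]
      have n1 : ¬ (T = insert α₁ (insert αₐ (C.erase φ))) := fun h => by
        have h1 : α₁ ∈ T := h ▸ Finset.mem_insert_self _ _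
        have h2 : αₐ ∈ T := h ▸ Finset.mem_insert_of_mem (Finset.mem_insert_self _ _)
        exact (Finset.ne_of_mem_erase hα₁A)
          ((hkey _ h1 (Finset.mem_of_mem_erase hα₁A)).trans (hkey _ h2 hαₐ).symm)
      have hZ' : insert αₐ (((insert α₁ (insert αₐ (C.erase φ)))ᶜ).erase φ) = (insert α₁ C)ᶜ := by
        ext x
        simp only [Finset.mem_insert, Finset.mem_erase, Finset.mem_compl, not_or, ne_eq]
        constructor
        · rintro (rfl | ⟨hxφ, hx1, hxa, hxC⟩)
          · exact ⟨fun h => (Finset.ne_of_mem_erase hα₁A) h.symm, hαC⟩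
          · exact ⟨hx1, fun h => hxC ⟨hxφ, h⟩⟩
        · rintro ⟨hx1, hxC⟩
          by_cases hxa : x = αₐ
          · exact Or.inl hxa
          · exact Or.inr ⟨fun h => hxC (h ▸ hφ), hx1, hxa, fun h => hxC h.2⟩
      simp only [hZ', disjoint_compl_and_union_iff, n1, if_false, zero_add,
        hTeq α₁ (Finset.mem_of_mem_erase hα₁A)]
      by_cases hp : T.erase v.1 = C ∧ v.1 = α₁
      · rw [if_pos hp, if_pos ⟨by omega, hul, by omega, hp⟩]
      · rw [if_neg hp, if_neg (fun h => hp h.2.2.2)]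
    · -- `|A| = 1`
      have hα₁eq := hα₁' (by omega)
      have hπk : π ⟨k₀, hkn⟩ = φ := by
        rw [show (⟨k₀, hkn⟩ : Fin n) = ⟨u - 1, hul⟩ from Fin.ext (show k₀ = u - 1 by omega), hπl]
      rw [hπk]
      have hK : insert φ (insert αₐ (C.erase φ)) = insert αₐ C := by
        ext x
        simp only [Finset.mem_insert, Finset.mem_erase, ne_eq]
        constructor
        · rintro (rfl | rfl | ⟨-, hxC⟩)
          · exact Or.inr hφ
          · exact Or.inl rfl
          · exact Or.inr hxC
        · rintro (rfl | hxC)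
          · exact Or.inr (Or.inl rfl)
          · by_cases hxφ : x = φ
            · exact Or.inl hxφ
            · exact Or.inr (Or.inr ⟨hxφ, hxC⟩)
      have n2 : ¬ (k₀ + 1 ≤ u - 1 ∧ u - 1 < n ∧ ¬ (k₀ + 1 ≤ (c₁ : ℕ) ∧ (c₁ : ℕ) < n) ∧
          Disjoint T (insert αₐ ((insert φ (insert αₐ (C.erase φ)))ᶜ.erase φ)) ∧
          T ∪ insert αₐ ((insert φ (insert αₐ (C.erase φ)))ᶜ.erase φ) = univ) := fun h => by omega
      rw [if_neg n2, add_zero, hK, ← hα₁eq]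
      simp only [hTeq α₁ (hα₁eq ▸ hαₐ)]
  rw [map_sub, map_mul, map_mul, map_mul, map_mul, evalExtra_perPoly k π _ _ hc01, eTS, e0S, eTU]
  by_cases hp : v.1 = α₁
  · have eX1 : eval (fun w : Fin n × Fin n => if π w.2 = w.1 ∨ (w.2 = (⟨u - 1, hul⟩ : Fin n) ∧ w.1 = π c₁) then (1 : k) else 0) (X v) = 1 := by
      rw [eval_X, hv2, if_pos]
      rcases Nat.lt_or_ge k₀ (u - 1) with hlt | hge
      · exact Or.inl (by rw [hp, hα₁ hlt])
      · exact Or.inr ⟨Fin.ext (show k₀ = u - 1 by omega), by rw [hp, hα₁' (by omega), hπc₁]⟩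
    rw [eX1, if_pos hp]
    by_cases hC : T.erase v.1 = C
    · rw [if_pos hC, if_pos ⟨hC, hp⟩]; ring
    · rw [if_neg hC, if_neg (fun h => hC h.1)]; ring
  · simp [hp]

end Extra

end Summit.ValiantsHypothesis.Theorems.RigidityForcesSymmetry.GrenetGauge
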